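import Literature.NumberTheory.IwasawaTheory.ClassicalMuVanishesLayerTwoUnitCertificateTwo
import HarnessLib

/-!
# The LAYER-TWO unit door, FLEXIBLE certificate (`p = 2`): `e_m = e_2` for all `m ≥ 2`, `μ₂ = 0`, `λ₂ = 0` from a unit `η` of `K₂ = K(θ)`
# and ANY `x, a, b ∈ 𝓞_K[θ]` with `η·x²·(a² − (2+θ)b²) − 1 ∈ 𝔓₁⁸ ∖ 𝔓₁⁹` — every hypothesis an identity or ideal membership in `𝓞_K`

Topic `NumberTheory/IwasawaTheory` (namespace = path).  THEOREMS ONLY (no definition, no named fact, no instance, no `sorry`); unconditional.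
Written by the prover seat `bsd-line-att-p3` g44 (cell `bsd-f1-sign2`, WIDTH-5 attach on route `AlignedTransportAtTwo`, crux C2
stmt-BirchSwinnertonDyer-22298; `--supports`, closes nothing).  Sequel of `ClassicalMuVanishesLayerTwoUnitCertificateTwo.lean` (this seat: the door with
the NORMAL-FORM certificate `η − 1 ∈ 𝔓₁⁸ ∖ 𝔓₁⁹`) and of `NumberFields/DyadicUnitSquaresRamifiedPrimeFour.lean` §5 (the flexible dyadic lemma
`unitsIncl_unitsMap_not_mem_map_norm_of_mul_sq_mul_sub_one_mem_pow_eight`, Brahmagupta's identity).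

WHY.  A non-norm unit `η` of `K₂` exists iff the door can fire (iff `e₃ = e₂`), but the normal form `η − 1 ∈ 𝔓₁⁸ ∖ 𝔓₁⁹` asks that the image of the
GLOBAL units of `K₂` in `(𝓞_{K₂}/𝔓₁⁹)ˣ` (order `2⁸`) meet one particular coset — which a given field need not grant.  Multiplying `η` by a square `x²`
and by a norm `a² − (2+θ)b² = N_{K₃/K₂}(a + b√(2+θ))` does not change its norm class, and with `x, a, b ∈ 𝓞_{K₂}` ARBITRARY every residue class modulo
`𝔓₁⁹` is reached (`𝓞 → 𝓞/𝔓₁⁹` is onto), so the certificate below ALWAYS exists when the door can fire.  The product `w = η·x²·(a² − (2+θ)b²)` is handed over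
by its `θ`-coordinates `W₀, …, W₃ ∈ 𝓞_K` together with the POLYNOMIAL IDENTITY `W(ϑ) = η(ϑ)·x(ϑ)²·(a(ϑ)² − (2+ϑ)b(ϑ)²)` at every root `ϑ` of `X⁴ − 4X² + 2`
in every `𝓞_K`-algebra (hypothesis `hW`; a consumer proves it once by `intro S _ _ ϑ hϑ; linear_combination (Q ϑ) * hϑ` with the quotient `Q` of one
polynomial division by `X⁴ − 4X² + 2`).

* ★★ `classNumberPExp_eq_of_le_of_layerTwo_flexCert` — odd degree, Fukuda index `0`, `2 ∤ h_K`, at most two primes above `2`, `N𝔭₁ = 2`, `2 ∉ 𝔭₁²`, the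
  unit identities for `η = A + Bθ + Cθ² + Dθ³`, coordinates `X_i, a_i, b_i, W_i ∈ 𝓞_K`, `hW`, and `d(W₀ − 1) = π₁²γ₀`, `dW_i = π₁²γ_i` (`i = 1,2,3`),
  `π₁ ∈ 𝔭₁ ∖ 𝔭₁²`, `d, γ₀ ∉ 𝔭₁` ⟹ `e_m = e_2` for all `m ≥ 2`; `classicalMuVanishes_two_of_layerTwo_flexCert` (`μ₂ = 0 ∧ λ₂ = 0`);
  `…_of_not_dvd_discr` (W-free consumer form for `2 ∤ d_K`).

HONEST SCOPE: packaging; nothing specific to any summit; no certificate for any field is asserted; BSD is not advanced by this file.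

## References

* T. Fukuda, *Remarks on `ℤ_p`-extensions of number fields*, Proc. Japan Acad. 70 A (1994), Thm. 1 (1), p. 264. [Fukuda1994]
* S. Lang, *Cyclotomic Fields I and II*, GTM 121 (1990), Ch. 13 §4, Lemma 4.1–4.2 and sequel (PDF pp. 203–204). [Lang1990]
* O. T. O'Meara, *Introduction to Quadratic Forms* (1963), §63B (63:10, 63:11a). [Omeara1963]
* L. C. Washington, *Introduction to Cyclotomic Fields*, 2nd ed. (1997), §13.3 Prop. 13.22. [Washington1997]
* J. Neukirch, *Algebraic Number Theory* (1999), Ch. III (2.12). [NeukirchANT1999]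
-/

noncomputable section

open NumberField IsDedekindDomain Field
open scoped nonZeroDivisors IntermediateField

namespace Literature.NumberTheory.IwasawaTheory

open Literature.NumberTheory.EllipticCurves Literature.NumberTheory.NumberFields
  Literature.NumberTheory.NumberFields.AmbiguousClass
  Literature.NumberTheory.GaloisRepresentations Literature.NumberTheory.GaloisRepresentations.Herbrand
  Literature.NumberTheory.GaloisRepresentations.MinkowskiUnit
  Literature.NumberTheory.GaloisRepresentations.CyclicNormIndex

/-! ## The door with the flexible certificate -/

section Flex

variable {K : Type} [Field K] [NumberField K] (κ : ZpExtension K 2)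

/-- ★★ **THE LAYER-TWO UNIT DOOR, FLEXIBLE CERTIFICATE: `e_m = e_2` for all `m ≥ 2`.**  Hypotheses as in
`ClassicalMuVanishesLayerTwoUnitCertificateTwo.classNumberPExp_eq_of_le_of_layerTwo_unitCert` (odd degree, Fukuda index `0`, `2 ∤ h_K`, at most two primes above `2`, `N𝔭₁ = 2`, `2 ∉ 𝔭₁²`, the unit
`η = A + Bθ + Cθ² + Dθ³` with inverse `A' + B'θ + C'θ² + D'θ³`), plus `x, a, b ∈ 𝓞_K[θ]` given by coordinates `X_i, a_i, b_i ∈ 𝓞_K`, the coordinates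
`W₀, …, W₃ ∈ 𝓞_K` of `w = η·x²·(a² − (2+θ)b²)` (hypothesis `hW`: the identity at every root `ϑ` of `X⁴ − 4X² + 2` in every `𝓞_K`-algebra), and the
certificate `d(W₀ − 1) = π₁²γ₀`, `dW₁ = π₁²γ₁`, `dW₂ = π₁²γ₂`, `dW₃ = π₁²γ₃` with `π₁ ∈ 𝔭₁ ∖ 𝔭₁²`, `d, γ₀ ∉ 𝔭₁`.  THEN `w − 1 ∈ 𝔓₁⁸ ∖ 𝔓₁⁹`
(companion `sub_one_mem_pow_eight_of_baseCert`), so `η ∉ N(K₃ˣ)` (tree `unitsIncl_unitsMap_not_mem_map_norm_of_mul_sq_mul_sub_one_mem_pow_eight`), and the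
one-unit door at the layer `n = 2` concludes. [cite: Fukuda1994, Thm. 1 (1), p. 264] [cite: Lang1990, Ch. 13 §4, Lemma 4.1–4.2 and sequel (PDF pp. 203–204)]
[cite: Omeara1963, §63B (63:10, 63:11a)] [cite: Washington1997, §13.3 Prop. 13.22] -/
theorem classNumberPExp_eq_of_le_of_layerTwo_flexCert (hκ : κ.IsCyclotomic) (hK2 : ¬ 2 ∣ Module.finrank ℚ K)
    (hram : TotallyRamifiedFrom κ 0) (hK : ¬ 2 ∣ classNumber K)
    (h2 : {v : HeightOneSpectrum (𝓞 K) | ((2 : ℕ) : 𝓞 K) ∈ v.asIdeal}.ncard ≤ 2)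
    (𝔭₁ : Ideal (𝓞 K)) (hN : Ideal.absNorm 𝔭₁ = 2) (hunr : (2 : 𝓞 K) ∉ 𝔭₁ ^ 2)
    {A B C D A' B' C' D' X₀ X₁ X₂ X₃ a₀ a₁ a₂ a₃ b₀ b₁ b₂ b₃ W₀ W₁ W₂ W₃ π₁ d γ₀ γ₁ γ₂ γ₃ : 𝓞 K}
    (h0 : A * A' - 2 * (B * D' + C * C' + D * B') - 8 * (D * D') = 1)
    (h1 : A * B' + B * A' - 2 * (C * D' + D * C') = 0)
    (h2c : A * C' + B * B' + C * A' + 4 * (B * D' + C * C' + D * B') + 14 * (D * D') = 0)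
    (h3 : A * D' + B * C' + C * B' + D * A' + 4 * (C * D' + D * C') = 0)
    (hW : ∀ (S : Type) [CommRing S] [Algebra (𝓞 K) S] (ϑ : S), ϑ ^ 4 - 4 * ϑ ^ 2 + 2 = 0 →
      algebraMap (𝓞 K) S W₀ + algebraMap (𝓞 K) S W₁ * ϑ + algebraMap (𝓞 K) S W₂ * ϑ ^ 2 +
          algebraMap (𝓞 K) S W₃ * ϑ ^ 3 =
        (algebraMap (𝓞 K) S A + algebraMap (𝓞 K) S B * ϑ + algebraMap (𝓞 K) S C * ϑ ^ 2 +
            algebraMap (𝓞 K) S D * ϑ ^ 3) *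
          (algebraMap (𝓞 K) S X₀ + algebraMap (𝓞 K) S X₁ * ϑ + algebraMap (𝓞 K) S X₂ * ϑ ^ 2 +
              algebraMap (𝓞 K) S X₃ * ϑ ^ 3) ^ 2 *
          ((algebraMap (𝓞 K) S a₀ + algebraMap (𝓞 K) S a₁ * ϑ + algebraMap (𝓞 K) S a₂ * ϑ ^ 2 +
                algebraMap (𝓞 K) S a₃ * ϑ ^ 3) ^ 2 -
            (2 + ϑ) * (algebraMap (𝓞 K) S b₀ + algebraMap (𝓞 K) S b₁ * ϑ + algebraMap (𝓞 K) S b₂ * ϑ ^ 2 +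
                algebraMap (𝓞 K) S b₃ * ϑ ^ 3) ^ 2))
    (hπ₁ : π₁ ∈ 𝔭₁) (hπ₁' : π₁ ∉ 𝔭₁ ^ 2) (hd : d ∉ 𝔭₁) (hγ₀ : γ₀ ∉ 𝔭₁)
    (hW0 : d * (W₀ - 1) = π₁ ^ 2 * γ₀) (hW1 : d * W₁ = π₁ ^ 2 * γ₁) (hW2 : d * W₂ = π₁ ^ 2 * γ₂)
    (hW3 : d * W₃ = π₁ ^ 2 * γ₃) {m : ℕ} (hm : 2 ≤ m) :
    classNumberPExp κ m = classNumberPExp κ 2 := by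
  classical
  haveI : Fact (Nat.Prime 2) := ⟨Nat.prime_two⟩
  -- the layers `K₂ ⊂ K₃`
  have h23 : κ.layer 2 ≤ κ.layer (2 + 1) := κ.layer_mono (by omega)
  letI : Algebra (κ.layer 2) (κ.layer (2 + 1)) := (IntermediateField.inclusion h23).toRingHom.toAlgebra
  haveI : IsScalarTower K (κ.layer 2) (κ.layer (2 + 1)) :=
    IsScalarTower.of_algebraMap_eq fun x => ((IntermediateField.inclusion h23).commutes x).symm
  haveI : FiniteDimensional K (κ.layer 2) := κ.finiteDimensional_layer_holds 2
  haveI : FiniteDimensional K (κ.layer (2 + 1)) := κ.finiteDimensional_layer_holds (2 + 1)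
  haveI : NumberField (κ.layer 2) := NumberField.of_module_finite K _
  haveI : NumberField (κ.layer (2 + 1)) := NumberField.of_module_finite K _
  haveI : IsGalois K (κ.layer 2) := κ.isGalois_layer_holds 2
  haveI : IsGalois K (κ.layer (2 + 1)) := κ.isGalois_layer_holds (2 + 1)
  haveI : IsGalois (κ.layer 2) (κ.layer (2 + 1)) := IsGalois.tower_top_of_isGalois K _ _
  haveI : FiniteDimensional (κ.layer 2) (κ.layer (2 + 1)) := Module.Finite.of_restrictScalars_finite K _ _
  have hdeg2 : Module.finrank K (κ.layer 2) = 4 := by rw [κ.finrank_layer_holds 2]; norm_num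
  have hdeg3 : Module.finrank (κ.layer 2) (κ.layer (2 + 1)) = 2 := finrank_layer_two_layer_three κ
  -- `θ ∈ K₂` (quartic root), `t = √(2+θ) ∈ K₃ ∖ K₂`
  obtain ⟨θ, hθ, t, ht, htK⟩ := exists_quartic_root_layer_two_sqrt_add_layer_three κ hK2 hκ
  have hθit : (fun x : κ.layer 2 => x ^ 2 - 2)^[2] θ = 0 := by
    rw [iterate_sq_sub_two_two]; linear_combination hθ
  set θO : 𝓞 (κ.layer 2) := ⟨θ, NestedSqrtTwo.isIntegral (R := ℤ) hθit⟩ with hθO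
  have hθO4 : θO ^ 4 - 4 * θO ^ 2 + 2 = 0 := by
    apply Subtype.ext
    change ((θO ^ 4 - 4 * θO ^ 2 + 2 : 𝓞 (κ.layer 2)) : κ.layer 2) = ((0 : 𝓞 (κ.layer 2)) : κ.layer 2)
    push_cast
    exact hθ
  set mO : 𝓞 (κ.layer 2) := 2 + θO with hmO
  have hmK : ((mO : 𝓞 (κ.layer 2)) : κ.layer 2) = 2 + θ := by rw [hmO, hθO]; rfl
  have hmt : t ^ 2 = algebraMap (κ.layer 2) (κ.layer (2 + 1)) (mO : κ.layer 2) := by rw [ht, hmK]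
  -- the prime `𝔭₁` and a prime `P` of `K₂` above it
  obtain ⟨h𝔭, h𝔭0, h2𝔭, -⟩ := isPrime_and_mem_of_absNorm_eq_two 𝔭₁ hN
  haveI := h𝔭
  haveI : 𝔭₁.IsMaximal := h𝔭.isMaximal h𝔭0
  obtain ⟨P, hPmax, hPover⟩ := Ideal.exists_maximal_ideal_liesOver_of_isIntegral (S := 𝓞 (κ.layer 2)) 𝔭₁
  haveI := hPmax
  haveI := hPover
  have hP0 : P ≠ ⊥ := Ideal.ne_bot_of_liesOver_of_ne_bot h𝔭0 P
  have hres := forall_mem_or_sub_one_mem_of_card_quotient_eq_two P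
    (card_quotient_eq_two_of_quartic_root hdeg2 hθO4 𝔭₁ hN hunr P)
  obtain ⟨⟨h2P4, h2P5⟩, -, hmP, hmP2⟩ := two_mem_pow_four_and_mem_of_quartic_root hdeg2 hθO4 𝔭₁ h2𝔭 hunr P
  -- the unit `η = A + B θ + C θ² + D θ³` of `𝓞 K₂`
  set f := algebraMap (𝓞 K) (𝓞 (κ.layer 2)) with hf
  have hq : θO ^ 4 = 4 * θO ^ 2 - 2 := by linear_combination hθO4
  have h0' := congrArg f h0
  have h1' := congrArg f h1
  have h2' := congrArg f h2c
  have h3' := congrArg f h3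
  simp only [map_add, map_sub, map_mul, map_ofNat, map_one, map_zero] at h0' h1' h2' h3'
  set η : (𝓞 (κ.layer 2))ˣ := Units.mkOfMulEqOne
    (f A + f B * θO + f C * θO ^ 2 + f D * θO ^ 3) (f A' + f B' * θO + f C' * θO ^ 2 + f D' * θO ^ 3)
    (by
      linear_combination h0' + θO * h1' + θO ^ 2 * h2' + θO ^ 3 * h3' +
        ((f B * f D' + f C * f C' + f D * f B') + (f C * f D' + f D * f C') * θO + f D * f D' * (θO ^ 2 + 4)) * hq)
    with hη
  -- the element `w = η x² (a² − (2+θ) b²)` and its coordinates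
  obtain ⟨xO, hxO⟩ : ∃ xO : 𝓞 (κ.layer 2), xO = f X₀ + f X₁ * θO + f X₂ * θO ^ 2 + f X₃ * θO ^ 3 := ⟨_, rfl⟩
  obtain ⟨aO, haO⟩ : ∃ aO : 𝓞 (κ.layer 2), aO = f a₀ + f a₁ * θO + f a₂ * θO ^ 2 + f a₃ * θO ^ 3 := ⟨_, rfl⟩
  obtain ⟨bO, hbO⟩ : ∃ bO : 𝓞 (κ.layer 2), bO = f b₀ + f b₁ * θO + f b₂ * θO ^ 2 + f b₃ * θO ^ 3 := ⟨_, rfl⟩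
  have hηval : (η : 𝓞 (κ.layer 2)) = f A + f B * θO + f C * θO ^ 2 + f D * θO ^ 3 := by
    rw [hη, Units.val_mkOfMulEqOne]
  have hid := hW (𝓞 (κ.layer 2)) θO hθO4
  rw [← hf, ← hxO, ← haO, ← hbO, ← hηval, ← hmO] at hid
  obtain ⟨h8, h9⟩ := sub_one_mem_pow_eight_of_baseCert hdeg2 hθO4 𝔭₁ h2𝔭 hunr P hπ₁ hπ₁' hd hγ₀ hW0 hW1 hW2 hW3
  rw [← hf, hid] at h8 h9
  -- `η ∉ N(K₃ˣ)` and the door at the layer `n = 2`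
  have hxE := unitsIncl_unitsMap_mem_unitsE_inf_range (K := κ.layer 2) (L := κ.layer (2 + 1)) η
  have hxN := unitsIncl_unitsMap_not_mem_map_norm_of_mul_sq_mul_sub_one_mem_pow_eight (K := κ.layer 2)
    (L := κ.layer (2 + 1)) hdeg3 hmt htK P hP0 hres h2P4 h2P5 hmP hmP2 η xO aO bO h8 h9
  have hs' : {w : HeightOneSpectrum (𝓞 (κ.layer 2)) |
      w.asIdeal.ramificationIdxIn (𝓞 (κ.layer (2 + 1))) ≠ 1}.ncard ≤ 2 :=
    (ncard_ramified_layer_succ_le κ 2 hram).trans h2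
  exact classNumberPExp_eq_of_le_two_of_nonNorm_unit_of_not_dvd κ 2 hram hK (Nat.zero_le 2) hs' hxE hxN hm

/-- ★★ **`μ₂ = 0` and `λ₂ = 0` from the flexible layer-two certificate** (hypotheses of `classNumberPExp_eq_of_le_of_layerTwo_flexCert`).
[cite: Fukuda1994, Thm. 1 (1), p. 264] [cite: Omeara1963, §63B (63:10, 63:11a)] -/
theorem classicalMuVanishes_two_of_layerTwo_flexCert (hκ : κ.IsCyclotomic) (hK2 : ¬ 2 ∣ Module.finrank ℚ K)
    (hram : TotallyRamifiedFrom κ 0) (hK : ¬ 2 ∣ classNumber K)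
    (h2 : {v : HeightOneSpectrum (𝓞 K) | ((2 : ℕ) : 𝓞 K) ∈ v.asIdeal}.ncard ≤ 2)
    (𝔭₁ : Ideal (𝓞 K)) (hN : Ideal.absNorm 𝔭₁ = 2) (hunr : (2 : 𝓞 K) ∉ 𝔭₁ ^ 2)
    {A B C D A' B' C' D' X₀ X₁ X₂ X₃ a₀ a₁ a₂ a₃ b₀ b₁ b₂ b₃ W₀ W₁ W₂ W₃ π₁ d γ₀ γ₁ γ₂ γ₃ : 𝓞 K}
    (h0 : A * A' - 2 * (B * D' + C * C' + D * B') - 8 * (D * D') = 1)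
    (h1 : A * B' + B * A' - 2 * (C * D' + D * C') = 0)
    (h2c : A * C' + B * B' + C * A' + 4 * (B * D' + C * C' + D * B') + 14 * (D * D') = 0)
    (h3 : A * D' + B * C' + C * B' + D * A' + 4 * (C * D' + D * C') = 0)
    (hW : ∀ (S : Type) [CommRing S] [Algebra (𝓞 K) S] (ϑ : S), ϑ ^ 4 - 4 * ϑ ^ 2 + 2 = 0 →
      algebraMap (𝓞 K) S W₀ + algebraMap (𝓞 K) S W₁ * ϑ + algebraMap (𝓞 K) S W₂ * ϑ ^ 2 +
          algebraMap (𝓞 K) S W₃ * ϑ ^ 3 =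
        (algebraMap (𝓞 K) S A + algebraMap (𝓞 K) S B * ϑ + algebraMap (𝓞 K) S C * ϑ ^ 2 +
            algebraMap (𝓞 K) S D * ϑ ^ 3) *
          (algebraMap (𝓞 K) S X₀ + algebraMap (𝓞 K) S X₁ * ϑ + algebraMap (𝓞 K) S X₂ * ϑ ^ 2 +
              algebraMap (𝓞 K) S X₃ * ϑ ^ 3) ^ 2 *
          ((algebraMap (𝓞 K) S a₀ + algebraMap (𝓞 K) S a₁ * ϑ + algebraMap (𝓞 K) S a₂ * ϑ ^ 2 +
                algebraMap (𝓞 K) S a₃ * ϑ ^ 3) ^ 2 -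
            (2 + ϑ) * (algebraMap (𝓞 K) S b₀ + algebraMap (𝓞 K) S b₁ * ϑ + algebraMap (𝓞 K) S b₂ * ϑ ^ 2 +
                algebraMap (𝓞 K) S b₃ * ϑ ^ 3) ^ 2))
    (hπ₁ : π₁ ∈ 𝔭₁) (hπ₁' : π₁ ∉ 𝔭₁ ^ 2) (hd : d ∉ 𝔭₁) (hγ₀ : γ₀ ∉ 𝔭₁)
    (hW0 : d * (W₀ - 1) = π₁ ^ 2 * γ₀) (hW1 : d * W₁ = π₁ ^ 2 * γ₁) (hW2 : d * W₂ = π₁ ^ 2 * γ₂)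
    (hW3 : d * W₃ = π₁ ^ 2 * γ₃) :
    ClassicalMuVanishes κ ∧ classicalLambda κ = 0 :=
  ⟨classicalMuVanishes_of_eventually_const κ (c := classNumberPExp κ 2) (n₀ := 2) fun _ hm =>
      classNumberPExp_eq_of_le_of_layerTwo_flexCert κ hκ hK2 hram hK h2 𝔭₁ hN hunr h0 h1 h2c h3 hW hπ₁ hπ₁' hd hγ₀
        hW0 hW1 hW2 hW3 hm,
    classicalLambda_eq_zero_of_eventually_const κ (c := classNumberPExp κ 2) (n₀ := 2) fun _ hm =>
      classNumberPExp_eq_of_le_of_layerTwo_flexCert κ hκ hK2 hram hK h2 𝔭₁ hN hunr h0 h1 h2c h3 hW hπ₁ hπ₁' hd hγ₀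
        hW0 hW1 hW2 hW3 hm⟩

/-- ★★ **The flexible door for an odd-degree field of odd discriminant** (`2 ∤ d_K` discharges Fukuda's index and `2 ∉ 𝔭₁²`): `2 ∤ h_K`, at most two
primes above `2`, `N𝔭₁ = 2`, the unit identities, the polynomial identity `hW` and the certificate on `W₀, …, W₃` ⟹ `μ₂ = 0 ∧ λ₂ = 0` for EVERY
cyclotomic `ℤ₂`-extension of `K`. [cite: Fukuda1994, Thm. 1 (1), p. 264] [cite: Omeara1963, §63B (63:10, 63:11a)] [cite: NeukirchANT1999, Ch. III (2.12)] -/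
theorem classicalMuVanishes_two_of_layerTwo_flexCert_of_not_dvd_discr (hκ : κ.IsCyclotomic)
    (hK2 : ¬ 2 ∣ Module.finrank ℚ K) (hdK : ¬ (2 : ℤ) ∣ NumberField.discr K) (hK : ¬ 2 ∣ classNumber K)
    (h2 : {v : HeightOneSpectrum (𝓞 K) | ((2 : ℕ) : 𝓞 K) ∈ v.asIdeal}.ncard ≤ 2)
    (𝔭₁ : Ideal (𝓞 K)) (hN : Ideal.absNorm 𝔭₁ = 2)
    {A B C D A' B' C' D' X₀ X₁ X₂ X₃ a₀ a₁ a₂ a₃ b₀ b₁ b₂ b₃ W₀ W₁ W₂ W₃ π₁ d γ₀ γ₁ γ₂ γ₃ : 𝓞 K}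
    (h0 : A * A' - 2 * (B * D' + C * C' + D * B') - 8 * (D * D') = 1)
    (h1 : A * B' + B * A' - 2 * (C * D' + D * C') = 0)
    (h2c : A * C' + B * B' + C * A' + 4 * (B * D' + C * C' + D * B') + 14 * (D * D') = 0)
    (h3 : A * D' + B * C' + C * B' + D * A' + 4 * (C * D' + D * C') = 0)
    (hW : ∀ (S : Type) [CommRing S] [Algebra (𝓞 K) S] (ϑ : S), ϑ ^ 4 - 4 * ϑ ^ 2 + 2 = 0 →
      algebraMap (𝓞 K) S W₀ + algebraMap (𝓞 K) S W₁ * ϑ + algebraMap (𝓞 K) S W₂ * ϑ ^ 2 +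
          algebraMap (𝓞 K) S W₃ * ϑ ^ 3 =
        (algebraMap (𝓞 K) S A + algebraMap (𝓞 K) S B * ϑ + algebraMap (𝓞 K) S C * ϑ ^ 2 +
            algebraMap (𝓞 K) S D * ϑ ^ 3) *
          (algebraMap (𝓞 K) S X₀ + algebraMap (𝓞 K) S X₁ * ϑ + algebraMap (𝓞 K) S X₂ * ϑ ^ 2 +
              algebraMap (𝓞 K) S X₃ * ϑ ^ 3) ^ 2 *
          ((algebraMap (𝓞 K) S a₀ + algebraMap (𝓞 K) S a₁ * ϑ + algebraMap (𝓞 K) S a₂ * ϑ ^ 2 +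
                algebraMap (𝓞 K) S a₃ * ϑ ^ 3) ^ 2 -
            (2 + ϑ) * (algebraMap (𝓞 K) S b₀ + algebraMap (𝓞 K) S b₁ * ϑ + algebraMap (𝓞 K) S b₂ * ϑ ^ 2 +
                algebraMap (𝓞 K) S b₃ * ϑ ^ 3) ^ 2))
    (hπ₁ : π₁ ∈ 𝔭₁) (hπ₁' : π₁ ∉ 𝔭₁ ^ 2) (hd : d ∉ 𝔭₁) (hγ₀ : γ₀ ∉ 𝔭₁)
    (hW0 : d * (W₀ - 1) = π₁ ^ 2 * γ₀) (hW1 : d * W₁ = π₁ ^ 2 * γ₁) (hW2 : d * W₂ = π₁ ^ 2 * γ₂)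
    (hW3 : d * W₃ = π₁ ^ 2 * γ₃) :
    ClassicalMuVanishes κ ∧ classicalLambda κ = 0 := by
  obtain ⟨h𝔭, -, h2𝔭, -⟩ := isPrime_and_mem_of_absNorm_eq_two 𝔭₁ hN
  haveI := h𝔭
  exact classicalMuVanishes_two_of_layerTwo_flexCert κ hκ hK2 (totallyRamifiedFrom_zero_of_not_dvd_discr hK2 hdK κ hκ)
    hK h2 𝔭₁ hN (two_not_mem_sq_of_not_dvd_discr hdK 𝔭₁ h2𝔭) h0 h1 h2c h3 hW hπ₁ hπ₁' hd hγ₀ hW0 hW1 hW2 hW3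

end Flex

end Literature.NumberTheory.IwasawaTheory

end
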